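import Summits.ResolutionOfSingularities.ResolutionOfSingularities.Theorems.WildConesCampaignW46FormalDictionary
import Summits.ResolutionOfSingularities.ResolutionOfSingularities.Theorems.WildConesCampaignW46ThreefoldsCharTwoFamily
import Literature.RingTheory.MvPowerSeries.MaximalIdealPow
import HarnessLib

/-!
# [OURS · L1 W4.6, rungs (i)/(ii) — the dictionary, SCHEME HALF, brick 2] The atom germ `z^p − a(u)` in the
# completed local ring `κ⟦z,u⟧`: the blow-up chart on the germ, its order, and the plug to formal-chart
# recognition

Cell res-hironaka (LADDER-RESOLUTION rung L, D-0089), slot W4.6, seat res-L1-s46-pv-2 (gen 2). Host: route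
`WildCones`, crux `ClassicalRegimes` (stmt-ResolutionOfSingularities-16884), `--supports … --as helper`.

HONEST FRAMING. Everything here is OURS — theorems about route `WildCones`' typed coefficient calculus
(`Theorems/WildConesClassicalRegimesDefs.lean`) and elementary power-series algebra; NOTHING here is a statement
of H. Hironaka's manuscript [Hironaka2017] and nothing of it is used; no FACT-LIST premise. AI review is weaker
than expert review.

## What this file adds to the dictionary

`Theorems/WildConesCampaignW46FormalDictionary.lean` (gen 0) proved the chart identity
`Ψ(z^p − a) = u_i^p (z^p − a′)` in the coordinate ring `κ⟦u⟧[z]` (polynomial in the fibre coordinate).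
The completed local ring of the ambient at the singular point is the POWER SERIES ring `κ⟦z,u⟧`; here it is
`MvPowerSeries (Option (Fin n)) κ` with `z = X none`, `u_j = X (some j)`, a `u`-series `g` being placed in it by
`MvPowerSeries.rename some`. This file proves, for a state `c` of multiplicity `p` over a perfect field:

* `subst_chartGerm_atom` — **the chart identity on the germ**: the substitution endomorphism `Ψ̂` of
  `κ⟦z,u⟧`, `z ↦ u_i (z + r)`, `u_i ↦ u_i`, `u_j ↦ u_i (u_j + τ_j)` (`r` = the cleaning shift), satisfies
  `Ψ̂ (z^p − a) = u_i^p · (z^p − a′)`, `a = ser c`, `a′ = ser (step i τ c)` (proved directly from the three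
  ingredients of the formal dictionary: `σ(a) = u_i^p T`, `a′ + pPowPart T = T`, `r^p = pPowPart T`);
* `ringHom_atom_eq` — **the plug to brick 1** (`Theorems/WildConesCampaignW46FormalChart.lean`,
  `FormalChart.exists_ringEquiv_chart_shear`): ANY ring endomorphism of `κ⟦z,u⟧` fixing the constants and
  taking the values `u_i`, `u_i (u_j + τ_j)`, `u_i (z + r)` on the variables — which is what formal-chart
  recognition delivers for `E ∘ π̂^♯` — IS `Ψ̂` (`ringHom_eq_subst_chartGerm`, by `Jets.algHom_apply_eq_subst`)
  and therefore carries the atom `z^p − a` to `u_i^p (z^p − a′)`: the controlled transform of the hypersurface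
  is again an atom, with the SUCCESSOR state, in the recognised formal coordinates at `ξ′`;
* the side conditions brick 1 asks of the shift `s = r − r(0)`: it has no constant term and does not involve
  `z` (`constantCoeff_rename_sub_C`, `kill_rename_some`);
* `atom_mem_maximalIdeal_pow_iff`, `atom_not_mem_maximalIdeal_pow_succ` — **the order of the atom**:
  `z^p − a ∈ 𝔪̂^p ⟺` every non-zero cleaned coefficient has degree `≥ p` (for `ser c ≠ 0` exactly `MultP c`,
  `multP_iff_atom_mem`), and `z^p − a ∉ 𝔪̂^{p+1}` always: the germ has order EXACTLY `p` in the regime, i.e.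
  the point lies in the top locus `{ord ≥ p}` of the ideal exponent `((z^p − a), p)` and the weak and the
  controlled transform of the blow-up coincide there.

NOT here (next bricks): `Isol c ⟺` the Tjurina algebra of the germ is finite over `κ`; the ring-level chart
facts feeding brick 1 (`chartQuotEquiv`); non-rational points.

References: route file `Theses/WildCones.lean` (crux `ClassicalRegimes`); `Theorems/WildConesCampaignW46Formal
Dictionary.lean`; `Literature/RingTheory/MvPowerSeries/MaximalIdealPow.lean` (jets = powers of `𝔪`, endomorphisms
are substitutions); H. Hironaka, ms. 2017, Th. 16.6 p.84 — ROLE of «the blowup `π : Z′ → Z`» only, under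
adjudication, not cited as fact. [folklore]
-/

noncomputable section

-- single-problem summit: the doubled namespace component `ResolutionOfSingularities` is forced
set_option linter.dupNamespace false

open scoped BigOperators Classical
open MvPowerSeries IsLocalRing

namespace Summit.ResolutionOfSingularities.ResolutionOfSingularities.Theorems

namespace CampaignW46.AtomGerm

open WildCones
open CampaignW46.FormalDictionary
open CampaignW46.ThreefoldsCharTwo (multP_iff_ser)
open Summit.ResolutionOfSingularities.ResolutionOfSingularities.Theorems.FrobeniusClosing (chartSubst)
open Summit.ResolutionOfSingularities.ResolutionOfSingularities.Theorems.FrobeniusClosing.FactorizationProof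
  (hasSubst_chartSubst constantCoeff_chartSubst chartSubst_eq_X_mul)
open Literature.RingTheory.MvPowerSeries.Jets (algHom_apply_eq_subst mem_maximalIdeal_pow_iff
  coeff_eq_zero_of_mem_maximalIdeal_pow le_order_iff_mem_maximalIdeal_pow)

variable {n : ℕ} {κ : Type} [Field κ] {p : ℕ}

/-! ## Placing `u`-series in `κ⟦z,u⟧`: `rename some` -/

/-- The placing family `u_j ↦ u_j` is substitutable. [folklore] -/
theorem hasSubst_X_some :
    HasSubst (fun j : Fin n => (X (some j) : MvPowerSeries (Option (Fin n)) κ)) :=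
  hasSubst_of_constantCoeff_zero fun _ => constantCoeff_X _

/-- `rename some` is the substitution `u_j ↦ u_j` into `κ⟦z,u⟧`. [folklore] -/
theorem rename_some_eq_subst (g : MvPowerSeries (Fin n) κ) :
    rename (some : Fin n → Option (Fin n)) g =
      subst (fun j : Fin n => (X (some j) : MvPowerSeries (Option (Fin n)) κ)) g :=
  rename_eq_subst some g

/-- A placed `u`-series keeps its constant coefficient. [folklore] -/
theorem constantCoeff_rename_some (g : MvPowerSeries (Fin n) κ) :
    constantCoeff (rename (some : Fin n → Option (Fin n)) g) = constantCoeff g :=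
  constantCoeff_rename some g

/-- [OURS · L1 W4.6] Side condition of brick 1 for the cleaning shift: `r − r(0)` (placed in `κ⟦z,u⟧`) has no
constant term. [folklore] -/
theorem constantCoeff_rename_sub_C (r : MvPowerSeries (Fin n) κ) :
    constantCoeff (rename (some : Fin n → Option (Fin n)) r - C (constantCoeff r)) = 0 := by
  rw [map_sub, constantCoeff_rename_some, constantCoeff_C, sub_self]

/-- [OURS · L1 W4.6] Side condition of brick 1 for the cleaning shift: a placed `u`-series does not involve
`z` — it is fixed by killing `z`. [folklore] -/
theorem kill_rename_some (g : MvPowerSeries (Fin n) κ) :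
    subst (fun o : Option (Fin n) => if o = none then (0 : MvPowerSeries (Option (Fin n)) κ) else X o)
      (rename (some : Fin n → Option (Fin n)) g) = rename (some : Fin n → Option (Fin n)) g := by
  have hk : HasSubst (fun o : Option (Fin n) =>
      if o = none then (0 : MvPowerSeries (Option (Fin n)) κ) else X o) :=
    hasSubst_of_constantCoeff_zero fun o => by by_cases ho : o = none <;> simp [ho]
  rw [rename_some_eq_subst, subst_comp_subst_apply hasSubst_X_some hk]
  congr 1
  funext j
  rw [subst_X hk]
  simp

/-- The same for `r − r(0)`. [folklore] -/
theorem kill_rename_sub_C (r : MvPowerSeries (Fin n) κ) :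
    subst (fun o : Option (Fin n) => if o = none then (0 : MvPowerSeries (Option (Fin n)) κ) else X o)
      (rename (some : Fin n → Option (Fin n)) r - C (constantCoeff r)) =
      rename (some : Fin n → Option (Fin n)) r - C (constantCoeff r) := by
  have hk : HasSubst (fun o : Option (Fin n) =>
      if o = none then (0 : MvPowerSeries (Option (Fin n)) κ) else X o) :=
    hasSubst_of_constantCoeff_zero fun o => by by_cases ho : o = none <;> simp [ho]
  rw [← substAlgHom_apply hk, map_sub, substAlgHom_apply, kill_rename_some, substAlgHom_apply, subst_C]

/-! ## The blow-up chart substitution `Ψ̂` on the germ `κ⟦z,u⟧` -/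

/-- The germ chart family `z ↦ u_i (z + r)`, `u_j ↦ σ_{i,τ}(u_j)` is substitutable. [folklore] -/
theorem hasSubst_chartGerm (i : Fin n) (τ : Fin n → κ) (r : MvPowerSeries (Fin n) κ) :
    HasSubst (fun o : Option (Fin n) => o.elim
      (X (some i) * (X none + rename (some : Fin n → Option (Fin n)) r))
      (fun j => rename (some : Fin n → Option (Fin n)) (chartSubst n κ i τ j)) :
        Option (Fin n) → MvPowerSeries (Option (Fin n)) κ) := by
  refine hasSubst_of_constantCoeff_zero fun o => ?_
  cases o with
  | none => simp
  | some j => simp [constantCoeff_chartSubst i τ j]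

/-- The placed chart substitution on `u_i` is `u_i`. [folklore] -/
theorem rename_chartSubst_self (i : Fin n) (τ : Fin n → κ) :
    rename (some : Fin n → Option (Fin n)) (chartSubst n κ i τ i) = X (some i) := by
  rw [chartSubst_eq_X_mul, if_pos rfl, mul_one, rename_X]

/-- The placed chart substitution on `u_j`, `j ≠ i`, is `u_i (u_j + τ_j)`. [folklore] -/
theorem rename_chartSubst_of_ne (i : Fin n) (τ : Fin n → κ) {j : Fin n} (hj : j ≠ i) :
    rename (some : Fin n → Option (Fin n)) (chartSubst n κ i τ j) = X (some i) * (X (some j) + C (τ j)) := by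
  rw [chartSubst_eq_X_mul, if_neg hj, map_mul, map_add, rename_X, rename_X, rename_C]

/-- `Ψ̂` on a placed `u`-series is the placed chart substitution `σ_{i,τ}`. [folklore] -/
theorem subst_chartGerm_rename (i : Fin n) (τ : Fin n → κ) (r g : MvPowerSeries (Fin n) κ) :
    subst (fun o : Option (Fin n) => o.elim
      (X (some i) * (X none + rename (some : Fin n → Option (Fin n)) r))
      (fun j => rename (some : Fin n → Option (Fin n)) (chartSubst n κ i τ j)))
      (rename (some : Fin n → Option (Fin n)) g) =
    rename (some : Fin n → Option (Fin n)) (subst (chartSubst n κ i τ) g) := by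
  rw [rename_some_eq_subst g, subst_comp_subst_apply hasSubst_X_some (hasSubst_chartGerm i τ r),
    rename_some_eq_subst (subst (chartSubst n κ i τ) g),
    subst_comp_subst_apply (hasSubst_chartSubst i τ) hasSubst_X_some]
  congr 1
  funext j
  rw [subst_X (hasSubst_chartGerm i τ r), ← rename_some_eq_subst]
  rfl

/-- `Ψ̂ z = u_i (z + r)`. [folklore] -/
theorem subst_chartGerm_X_none (i : Fin n) (τ : Fin n → κ) (r : MvPowerSeries (Fin n) κ) :
    subst (fun o : Option (Fin n) => o.elim
      (X (some i) * (X none + rename (some : Fin n → Option (Fin n)) r))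
      (fun j => rename (some : Fin n → Option (Fin n)) (chartSubst n κ i τ j)))
      (X none : MvPowerSeries (Option (Fin n)) κ) =
    X (some i) * (X none + rename (some : Fin n → Option (Fin n)) r) := by
  rw [subst_X (hasSubst_chartGerm i τ r)]
  rfl

/-- `Ψ̂ u_i = u_i`. [folklore] -/
theorem subst_chartGerm_X_some_self (i : Fin n) (τ : Fin n → κ) (r : MvPowerSeries (Fin n) κ) :
    subst (fun o : Option (Fin n) => o.elim
      (X (some i) * (X none + rename (some : Fin n → Option (Fin n)) r))
      (fun j => rename (some : Fin n → Option (Fin n)) (chartSubst n κ i τ j)))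
      (X (some i) : MvPowerSeries (Option (Fin n)) κ) = X (some i) := by
  rw [subst_X (hasSubst_chartGerm i τ r)]
  exact rename_chartSubst_self i τ

/-- `Ψ̂ u_j = u_i (u_j + τ_j)` for `j ≠ i`. [folklore] -/
theorem subst_chartGerm_X_some_of_ne (i : Fin n) (τ : Fin n → κ) (r : MvPowerSeries (Fin n) κ) {j : Fin n}
    (hj : j ≠ i) :
    subst (fun o : Option (Fin n) => o.elim
      (X (some i) * (X none + rename (some : Fin n → Option (Fin n)) r))
      (fun j => rename (some : Fin n → Option (Fin n)) (chartSubst n κ i τ j)))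
      (X (some j) : MvPowerSeries (Option (Fin n)) κ) = X (some i) * (X (some j) + C (τ j)) := by
  rw [subst_X (hasSubst_chartGerm i τ r)]
  exact rename_chartSubst_of_ne i τ hj

/-- [OURS · L1 W4.6 — DICTIONARY on the GERM; replaces the role of «the blowup `π : Z′ → Z` with center `D`»
(H. Hironaka, ms. 2017, Th. 16.6 p.84 l.4–8) on completed local rings — chart `u_i`, point `(τ, r(0))`,
cleaned fibre coordinate; NOT a statement of the manuscript] **The chart identity on `κ⟦z,u⟧`**: for a state
`c` of multiplicity `p` over a perfect field of characteristic `p`, with `r` the cleaning shift,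
`Ψ̂ (z^p − ser c) = u_i^p · (z^p − ser (step i τ c))`. [folklore] -/
theorem subst_chartGerm_atom [Fact p.Prime] [CharP κ p] [PerfectField κ] (c : (Fin n → ℕ) → κ)
    (i : Fin n) (τ : Fin n → κ) (hM : MultP p n κ c) :
    subst (fun o : Option (Fin n) => o.elim
      (X (some i) * (X none + rename (some : Fin n → Option (Fin n)) (cleaningShift p n κ c i τ)))
      (fun j => rename (some : Fin n → Option (Fin n)) (chartSubst n κ i τ j)))
      ((X none : MvPowerSeries (Option (Fin n)) κ) ^ p - rename (some : Fin n → Option (Fin n)) (ser p n κ c)) =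
    X (some i) ^ p * ((X none : MvPowerSeries (Option (Fin n)) κ) ^ p -
      rename (some : Fin n → Option (Fin n)) (ser p n κ (step p n κ i τ c))) := by
  haveI : CharP (MvPowerSeries (Option (Fin n)) κ) p :=
    charP_of_injective_ringHom (f := (C : κ →+* MvPowerSeries (Option (Fin n)) κ)) C_injective p
  set r := cleaningShift p n κ c i τ with hr
  have hΨ := hasSubst_chartGerm i τ r
  rw [← substAlgHom_apply hΨ, map_sub, map_pow, substAlgHom_apply, substAlgHom_apply,
    subst_chartGerm_X_none, subst_chartGerm_rename, subst_chartSubst_ser c i τ hM, mul_pow, add_pow_expChar,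
    ← map_pow, hr, cleaningShift_pow, map_mul, map_pow, rename_X]
  set T := moveSer p n κ c i τ with hT
  have hsplit : rename (some : Fin n → Option (Fin n)) T =
      rename (some : Fin n → Option (Fin n)) (ser p n κ (step p n κ i τ c)) +
        rename (some : Fin n → Option (Fin n)) (pPowPart p n κ T) := by
    rw [← map_add, ser_step_add_pPowPart c i τ hM]
  rw [hsplit]
  ring

/-! ## The plug to formal-chart recognition (brick 1) -/

/-- [OURS · L1 W4.6] A ring endomorphism of `κ⟦z,u⟧` fixing the constants with the chart values on the
variables — `u_i ↦ u_i`, `u_j ↦ u_i (u_j + τ_j)` (`j ≠ i`), `z ↦ u_i (z + r)` — IS the germ chart substitution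
`Ψ̂` (every `κ`-algebra endomorphism of a power series ring is the substitution of its values,
`Jets.algHom_apply_eq_subst`). These are exactly the values delivered by
`FormalChart.exists_ringEquiv_chart_shear` for `E ∘ π̂^♯` (with `τ none = r(0)`, `s = r − r(0)`). [folklore] -/
theorem ringHom_eq_subst_chartGerm (g : MvPowerSeries (Option (Fin n)) κ →+* MvPowerSeries (Option (Fin n)) κ)
    (hC : ∀ l, g (C l) = C l) (i : Fin n) (τ : Fin n → κ) (r : MvPowerSeries (Fin n) κ)
    (hi : g (X (some i)) = X (some i))
    (hj : ∀ j, j ≠ i → g (X (some j)) = X (some i) * (X (some j) + C (τ j)))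
    (hz : g (X none) = X (some i) * (X none + rename (some : Fin n → Option (Fin n)) r))
    (f : MvPowerSeries (Option (Fin n)) κ) :
    g f = subst (fun o : Option (Fin n) => o.elim
      (X (some i) * (X none + rename (some : Fin n → Option (Fin n)) r))
      (fun j => rename (some : Fin n → Option (Fin n)) (chartSubst n κ i τ j))) f := by
  let gₐ : MvPowerSeries (Option (Fin n)) κ →ₐ[κ] MvPowerSeries (Option (Fin n)) κ :=
    { g with
      commutes' := fun l => by
        simp only [RingHom.toMonoidHom_eq_coe, OneHom.toFun_eq_coe, MonoidHom.toOneHom_coe,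
          MonoidHom.coe_coe, MvPowerSeries.algebraMap_apply, Algebra.algebraMap_self, RingHom.id_apply]
        exact hC l }
  have h := algHom_apply_eq_subst gₐ f
  have hval : (fun s : Option (Fin n) => gₐ (X s)) = fun o : Option (Fin n) => o.elim
      (X (some i) * (X none + rename (some : Fin n → Option (Fin n)) r))
      (fun j => rename (some : Fin n → Option (Fin n)) (chartSubst n κ i τ j)) := by
    funext o
    cases o with
    | none => exact hz
    | some j =>
      by_cases hji : j = i
      · subst hji
        exact hi.trans (rename_chartSubst_self j τ).symm
      · exact (hj j hji).trans (rename_chartSubst_of_ne i τ hji).symm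
  rw [hval] at h
  exact h

/-- [OURS · L1 W4.6 — DICTIONARY, SCHEME HALF, bricks 1+2 composed on the germ; replaces the role of «the
transform `E′` of `E` by the blowup `π`» (H. Hironaka, ms. 2017, Th. 16.6 p.84, Def. 2.1 p.5) for the atom
`z^p = a(u)` on completed local rings; NOT a statement of the manuscript] **The controlled transform of an atom
is the successor atom.** If a ring endomorphism `g` of `κ⟦z,u⟧` fixes constants and has the chart values of the
move `(i, τ)` with the cleaning shift `r` of the state `c` (multiplicity `p`, perfect `κ`) on the variables —
the conclusion of formal-chart recognition for `E ∘ π̂^♯` — then `g (z^p − ser c) = u_i^p · (z^p − ser c′)`,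
`c′ = step i τ c`: the image of the atom is `u_i^p` (exceptional parameter to the `p`) times the atom of the
SUCCESSOR state. [folklore] -/
theorem ringHom_atom_eq [Fact p.Prime] [CharP κ p] [PerfectField κ]
    (g : MvPowerSeries (Option (Fin n)) κ →+* MvPowerSeries (Option (Fin n)) κ)
    (hC : ∀ l, g (C l) = C l) (c : (Fin n → ℕ) → κ) (i : Fin n) (τ : Fin n → κ) (hM : MultP p n κ c)
    (hi : g (X (some i)) = X (some i))
    (hj : ∀ j, j ≠ i → g (X (some j)) = X (some i) * (X (some j) + C (τ j)))
    (hz : g (X none) = X (some i) * (X none + rename (some : Fin n → Option (Fin n)) (cleaningShift p n κ c i τ))) :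
    g ((X none : MvPowerSeries (Option (Fin n)) κ) ^ p - rename (some : Fin n → Option (Fin n)) (ser p n κ c)) =
    X (some i) ^ p * ((X none : MvPowerSeries (Option (Fin n)) κ) ^ p -
      rename (some : Fin n → Option (Fin n)) (ser p n κ (step p n κ i τ c))) := by
  rw [ringHom_eq_subst_chartGerm g hC i τ _ hi hj hz]
  exact subst_chartGerm_atom c i τ hM

/-! ## The order of the atom germ -/

/-- `ser c` has no constant term (the zero exponent is divisible by `p`, so cleaning deletes it). [folklore] -/
theorem constantCoeff_ser (c : (Fin n → ℕ) → κ) : constantCoeff (ser p n κ c) = 0 := by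
  rw [← coeff_zero_eq_constantCoeff_apply, MuDropCharTwoOrdP.coeff_ser]
  unfold clean
  rw [if_pos]
  intro j
  exact dvd_zero p

/-- `rename some` is local: it maps `𝔪` into `𝔪̂`. [folklore] -/
theorem map_rename_some_maximalIdeal_le :
    (maximalIdeal (MvPowerSeries (Fin n) κ)).map
        (rename (some : Fin n → Option (Fin n)) : MvPowerSeries (Fin n) κ →ₐ[κ] _) ≤
      maximalIdeal (MvPowerSeries (Option (Fin n)) κ) := by
  rw [Ideal.map_le_iff_le_comap]
  intro g hg
  rw [Ideal.mem_comap, Literature.RingTheory.MvPowerSeries.Jets.mem_maximalIdeal_iff_constantCoeff_eq_zero,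
    constantCoeff_rename_some]
  exact Literature.RingTheory.MvPowerSeries.Jets.mem_maximalIdeal_iff_constantCoeff_eq_zero.1 hg

/-- A placed `u`-series of order `≥ N` lies in `𝔪̂^N`: `rename some` maps `𝔪^N` into `𝔪̂^N`. [folklore] -/
theorem rename_some_mem_maximalIdeal_pow {N : ℕ} {g : MvPowerSeries (Fin n) κ}
    (hg : g ∈ maximalIdeal (MvPowerSeries (Fin n) κ) ^ N) :
    rename (some : Fin n → Option (Fin n)) g ∈ maximalIdeal (MvPowerSeries (Option (Fin n)) κ) ^ N := by
  have hle : (maximalIdeal (MvPowerSeries (Fin n) κ) ^ N).map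
      (rename (some : Fin n → Option (Fin n)) : MvPowerSeries (Fin n) κ →ₐ[κ] _) ≤
      maximalIdeal (MvPowerSeries (Option (Fin n)) κ) ^ N := by
    rw [Ideal.map_pow]
    exact Ideal.pow_right_mono map_rename_some_maximalIdeal_le N
  exact hle (Ideal.mem_map_of_mem _ hg)

/-- Embedding an exponent along `some` does not change its degree. [folklore] -/
theorem degree_embDomain_some (d : Fin n →₀ ℕ) :
    (Finsupp.embDomain ⟨some, Option.some_injective _⟩ d : Option (Fin n) →₀ ℕ).degree = d.degree := by
  rw [Finsupp.degree_eq_sum, Finsupp.degree_eq_sum, Fintype.sum_option, Finsupp.embDomain_notin_range,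
    zero_add]
  · refine Finset.sum_congr rfl fun j _ => ?_
    exact Finsupp.embDomain_apply_self _ d j
  · rintro ⟨j, hj⟩
    exact Option.some_ne_none j hj

/-- Conversely, a `u`-series whose placement lies in `𝔪̂^N` lies in `𝔪^N` (coefficients are preserved).
[folklore] -/
theorem mem_maximalIdeal_pow_of_rename_some {N : ℕ} {g : MvPowerSeries (Fin n) κ}
    (hg : rename (some : Fin n → Option (Fin n)) g ∈ maximalIdeal (MvPowerSeries (Option (Fin n)) κ) ^ N) :
    g ∈ maximalIdeal (MvPowerSeries (Fin n) κ) ^ N := by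
  rw [mem_maximalIdeal_pow_iff] at hg ⊢
  intro d hd
  have h := hg (Finsupp.embDomain ⟨some, Option.some_injective _⟩ d) (by rw [degree_embDomain_some]; exact hd)
  rwa [show (rename (some : Fin n → Option (Fin n)) g) =
      rename (⟨some, Option.some_injective _⟩ : Fin n ↪ Option (Fin n)) g from rfl,
    coeff_embDomain_rename] at h

/-- [OURS · L1 W4.6] **Order of the atom, I**: `z^p − a ∈ 𝔪̂^p` iff `a ∈ 𝔪^p` (`a` any `u`-series).
[folklore] -/
theorem atom_mem_maximalIdeal_pow_iff (a : MvPowerSeries (Fin n) κ) :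
    (X none : MvPowerSeries (Option (Fin n)) κ) ^ p - rename (some : Fin n → Option (Fin n)) a ∈
        maximalIdeal (MvPowerSeries (Option (Fin n)) κ) ^ p ↔
      a ∈ maximalIdeal (MvPowerSeries (Fin n) κ) ^ p := by
  have hz : (X none : MvPowerSeries (Option (Fin n)) κ) ^ p ∈
      maximalIdeal (MvPowerSeries (Option (Fin n)) κ) ^ p :=
    Ideal.pow_mem_pow (Literature.RingTheory.MvPowerSeries.Jets.mem_maximalIdeal_iff_constantCoeff_eq_zero.2
      (constantCoeff_X _)) p
  constructor
  · intro h
    have h2 : rename (some : Fin n → Option (Fin n)) a ∈ maximalIdeal (MvPowerSeries (Option (Fin n)) κ) ^ p := by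
      have := Ideal.sub_mem _ hz h
      rwa [sub_sub_cancel] at this
    exact mem_maximalIdeal_pow_of_rename_some h2
  · intro h
    exact Ideal.sub_mem _ hz (rename_some_mem_maximalIdeal_pow h)

/-- [OURS · L1 W4.6] **Order of the atom, II**: `z^p − a ∉ 𝔪̂^{p+1}` — the coefficient of `z^p` is `1`
(`p ≠ 0`). So in the regime the germ `z^p = a(u)` has order EXACTLY `p`: its point lies in the top locus
`{ord ≥ p}` of the ideal exponent `((z^p − a), p)`, where weak and controlled transform agree. [folklore] -/
theorem atom_not_mem_maximalIdeal_pow_succ (hp : p ≠ 0) (a : MvPowerSeries (Fin n) κ) :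
    (X none : MvPowerSeries (Option (Fin n)) κ) ^ p - rename (some : Fin n → Option (Fin n)) a ∉
      maximalIdeal (MvPowerSeries (Option (Fin n)) κ) ^ (p + 1) := by
  intro h
  have hc := coeff_eq_zero_of_mem_maximalIdeal_pow h (e := Finsupp.single none p)
    (by rw [Finsupp.degree_single]; exact Nat.lt_succ_self p)
  rw [map_sub, coeff_X_pow, if_pos rfl, coeff_rename_eq_zero, sub_zero] at hc
  · exact one_ne_zero hc
  · rintro ⟨d, hd⟩
    have h0 := congrArg (fun e : Option (Fin n) →₀ ℕ => e none) hd
    simp only [Finsupp.single_eq_same] at h0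
    rw [Finsupp.mapDomain_notin_range] at h0
    · exact hp h0.symm
    · simp

/-- [OURS · L1 W4.6 — DICTIONARY: the multiplicity predicate; replaces the role of «`ξ ∈ Sing(E)`,
`E = (J, b)`, i.e. `ord_ξ J ≥ b`» (H. Hironaka, ms. 2017, §2 p.4) for the atom `((z^p − a), p)` on the completed
local ring; NOT a statement of the manuscript] **`MultP` is «order `≥ p`»**: a state `c` has multiplicity `p`
iff its cleaned series is non-zero and the atom `z^p − ser c` lies in `𝔪̂^p` (then its order is exactly `p`,
`atom_not_mem_maximalIdeal_pow_succ`). [folklore] -/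
theorem multP_iff_atom_mem (c : (Fin n → ℕ) → κ) :
    MultP p n κ c ↔ ser p n κ c ≠ 0 ∧
      (X none : MvPowerSeries (Option (Fin n)) κ) ^ p - rename (some : Fin n → Option (Fin n)) (ser p n κ c) ∈
        maximalIdeal (MvPowerSeries (Option (Fin n)) κ) ^ p := by
  rw [multP_iff_ser, atom_mem_maximalIdeal_pow_iff, le_order_iff_mem_maximalIdeal_pow]

end CampaignW46.AtomGerm

end Summit.ResolutionOfSingularities.ResolutionOfSingularities.Theorems

end
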